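import Summits.Ventures.HSemireg.WedgeModelCoord

/-!
# Venture HSemireg — THEOREM H (1/4): tuple maps, joint ranges, block Hankel matrices and doubling

HONEST FRAMING. Part of the Lean index of the computation cell `pub-hsemireg` (seat p3; Sunday enclosure of the
FORMULA-N kernel assets of seats th-7 / th-6, ENCLOSURE-PLAN-p3.md).  Finite-dimensional exterior algebra over a field ONLY:
no variety, no cohomology theory, no semiregularity map is constructed here; nothing here says that HC / HC_CM / HC_AV holds;
no Literature fact is declared or used.  The geometric DICTIONARY (why these ranks are the `HT`-side box ranks of the cell's
STRUCTURE.md §1 / theory/FORMULA-N.md) lives in theory/FORMULA-N-th7.md PART B §A.3 / §N and is NOT asserted in Lean.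

THEOREM H (general Hankel / catalecticant law, FORMULA-N PART A §2.6; th-7 HankelRank.lean v1 3e9043874d57f0b1), file 1 of 4:
tuple maps (`L f θ := (θ ∧ f_c)_c`, `L2`, `Lam23`, `Lam4`), joint ranges `JR D k f := (Hom D k).map (L f)` and their sums `JRsum`,
`piAlg`, `finrank_map_of_injOn`; and the BLOCK HANKEL MATRICES `hank m k q : Matrix (α × Fin (k+1)) (β × Fin (m+1−k)) K` (entry
`q a j (i+s)`) with the two doubling identities — COLUMN doubling `rank_hank_col` (`𝓗^{(m+1)}_k(q) ~ 𝓗^{(m)}_k(q ∣ σq)`) and ROW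
doubling `rank_hank_row` (`𝓗^{(m+1)}_{k+1}(q) ~ 𝓗^{(m)}_k(σq ; q)`), `σ` = `shift`.  th-7's statements and proofs, unchanged
(namespace `HSemiregHankel` ↦ `Summit.Ventures.HSemireg.Wedge.Hankel`).
-/

open Module Set Set.powersetCard

namespace Summit.Ventures.HSemireg.Wedge.Hankel

variable (K : Type*) [Field K] {I : Type*} [LinearOrder I] [Fintype I]

section Tuples

variable {β : Type*}

/-- `L f θ = (θ ∧ f_c)_c`. -/
noncomputable def L (f : β → HT K I) : HT K I →ₗ[K] (β → HT K I) :=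
  LinearMap.pi fun c => LinearMap.mulRight K (f c)

omit [LinearOrder I] [Fintype I] in
/-- `L f θ c = θ * f c`. -/
@[simp] lemma L_apply (f : β → HT K I) (θ : HT K I) (c : β) : L K f θ c = θ * f c := rfl

/-- `L2 f g θ = ((θ ∧ f_c)_c, (θ ∧ g_c)_c)`. -/
noncomputable def L2 (f g : β → HT K I) : HT K I →ₗ[K] (β → HT K I) × (β → HT K I) :=
  LinearMap.prod (L K f) (L K g)

omit [LinearOrder I] [Fintype I] in
/-- `L2 f g θ = (L f θ, L g θ)`. -/
@[simp] lemma L2_apply (f g : β → HT K I) (θ : HT K I) : L2 K f g θ = (L K f θ, L K g θ) := rfl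

/-- `Λ₂₃ (g₁, g₂) = (g₁_c x + g₂_c y)_c`. -/
noncomputable def Lam23 (i j : I) : ((β → HT K I) × (β → HT K I)) →ₗ[K] (β → HT K I) where
  toFun g := fun c => g.1 c * gx K i + g.2 c * gx K j
  map_add' g h := by
    funext c
    simp only [Prod.fst_add, Prod.snd_add, Pi.add_apply, add_mul]
    abel
  map_smul' r g := by
    funext c
    simp only [Prod.smul_fst, Prod.smul_snd, Pi.smul_apply, smul_mul_assoc, smul_add, RingHom.id_apply]

/-- `Lam23 i j g c = g.1 c · x_i + g.2 c · x_j`. -/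
@[simp] lemma Lam23_apply (i j : I) (g : (β → HT K I) × (β → HT K I)) (c : β) :
    Lam23 K i j g c = g.1 c * gx K i + g.2 c * gx K j := rfl

/-- `Λ₄ h = (h_c (x y))_c`. -/
noncomputable def Lam4 (i j : I) : (β → HT K I) →ₗ[K] (β → HT K I) :=
  LinearMap.pi fun c => (LinearMap.mulRight K (gx K i * gx K j)).comp (LinearMap.proj c)

/-- `Lam4 i j h c = h c · (x_i x_j)`. -/
@[simp] lemma Lam4_apply (i j : I) (h : β → HT K I) (c : β) : Lam4 K i j h c = h c * (gx K i * gx K j) := rfl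

variable (I) in
/-- the joint range of `θ ↦ (θ ∧ f_c)_c` on the degree-`k` part supported on `E`. -/
noncomputable def JR (E : Finset I) (k : ℕ) (f : β → HT K I) : Submodule K (β → HT K I) :=
  (Hom K I E k).map (L K f)

variable (I) in
/-- the sum over the rows `a` of the joint ranges. -/
noncomputable def JRsum {α : Type*} (E : Finset I) (k : ℕ) (F : α → β → HT K I) :
    Submodule K (β → HT K I) :=
  ⨆ a, JR K I E k (F a)

/-- tuples with values in `Alg D`. -/
noncomputable def piAlg (D : Finset I) : Submodule K (β → HT K I) :=
  Submodule.pi Set.univ fun _ => Alg K I D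

/-- membership in `piAlg D`: every component lies in `Alg D`. -/
lemma mem_piAlg {D : Finset I} {g : β → HT K I} : g ∈ piAlg K (β := β) D ↔ ∀ c, g c ∈ Alg K I D := by
  simp [piAlg, Submodule.mem_pi]

/-- the joint range `JR D k f` of a `D`-homogeneous tuple lies in `piAlg D`. -/
lemma JR_le_piAlg {D : Finset I} {k d : ℕ} {f : β → HT K I} (hf : ∀ c, f c ∈ Hom K I D d) :
    JR K I D k f ≤ piAlg K D := by
  rintro _ ⟨θ, hθ, rfl⟩
  rw [mem_piAlg]
  intro c
  exact mul_mem_Alg K (Hom_le_Alg K D k hθ) (Hom_le_Alg K D d (hf c))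

/-- generic: a map injective on `P` preserves `finrank P`. -/
lemma finrank_map_of_injOn {M N : Type*} [AddCommGroup M] [Module K M] [AddCommGroup N] [Module K N]
    [Module.Finite K M] (f : M →ₗ[K] N) (P : Submodule K M) (h : ∀ x ∈ P, f x = 0 → x = 0) :
    Module.finrank K (P.map f) = Module.finrank K P := by
  have hinj : Function.Injective (f.comp P.subtype) := by
    rw [← LinearMap.ker_eq_bot, LinearMap.ker_eq_bot']
    rintro ⟨x, hx⟩ hx0
    exact Subtype.ext (h x hx hx0)
  rw [← LinearMap.finrank_range_of_inj hinj, LinearMap.range_comp, Submodule.range_subtype]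

end Tuples

/-! ### Block Hankel matrices and the two doubling identities -/

section Matrices

variable {α β : Type*} [Fintype α] [Fintype β] [DecidableEq α] [DecidableEq β]

/-- shift of a sequence. -/
def shift (c : ℕ → K) : ℕ → K := fun t => c (t + 1)

omit [Field K] in
/-- `shift c t = c (t+1)`. -/
@[simp] lemma shift_apply (c : ℕ → K) (t : ℕ) : shift K c t = c (t + 1) := rfl

/-- block Hankel matrix with `k+1` row-offsets and `c` column-offsets: entry `q a j (i + s)`. -/
def hank' (k c : ℕ) (q : α → β → ℕ → K) : Matrix (α × Fin (k + 1)) (β × Fin c) K :=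
  Matrix.of fun r s => q r.1 s.1 ((r.2 : ℕ) + (s.2 : ℕ))

/-- the block Hankel matrix `𝓗^{(m)}_k[q]`: rows `(a, i ≤ k)`, columns `(j, s ≤ m − k)`. -/
def hank (m k : ℕ) (q : α → β → ℕ → K) : Matrix (α × Fin (k + 1)) (β × Fin (m + 1 - k)) K :=
  hank' K k (m + 1 - k) q

/-- columns doubled. -/
def qcol (q : α → β → ℕ → K) : α → (β ⊕ β) → ℕ → K :=
  fun a => Sum.elim (q a) (fun j => shift K (q a j))

/-- rows doubled (shifted rows first, matching `rowDbl`). -/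
def qrow (q : α → β → ℕ → K) : (α ⊕ α) → β → ℕ → K :=
  Sum.elim (fun a j => shift K (q a j)) q

omit [Fintype α] [DecidableEq α] [DecidableEq β] in
/-- COLUMN DOUBLING: the columns of `𝓗'_k[c+1](q)` are those of `𝓗'_k[c](q ∣ σq)` (c ≥ 1). -/
lemma rank_hank'_col (k c : ℕ) (hc : 0 < c) (q : α → β → ℕ → K) :
    (hank' K k (c + 1) q).rank = (hank' K k c (qcol K q)).rank := by
  have hr : Set.range (hank' K k (c + 1) q).col = Set.range (hank' K k c (qcol K q)).col := by
    ext v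
    constructor
    · rintro ⟨⟨j, s⟩, rfl⟩
      by_cases hs : (s : ℕ) < c
      · refine ⟨⟨Sum.inl j, ⟨s, hs⟩⟩, ?_⟩
        funext r
        simp [hank', qcol, Matrix.col]
      · have hs' : (s : ℕ) = c := by have := s.2; omega
        refine ⟨⟨Sum.inr j, ⟨c - 1, by omega⟩⟩, ?_⟩
        funext r
        simp only [hank', qcol, Matrix.col, Matrix.transpose_apply, Matrix.of_apply, Sum.elim_inr,
          shift_apply]
        congr 1; omega
    · rintro ⟨⟨j, s⟩, rfl⟩
      rcases j with j | j
      · refine ⟨⟨j, ⟨s, by omega⟩⟩, ?_⟩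
        funext r
        simp [hank', qcol, Matrix.col]
      · refine ⟨⟨j, ⟨s + 1, by omega⟩⟩, ?_⟩
        funext r
        simp only [hank', qcol, Matrix.col, Matrix.transpose_apply, Matrix.of_apply, Sum.elim_inr,
          shift_apply]
        rfl
  rw [Matrix.rank_eq_finrank_span_cols, Matrix.rank_eq_finrank_span_cols, hr]

omit [DecidableEq α] [DecidableEq β] in
/-- ROW DOUBLING: the rows of `𝓗'_{k+1}[c](q)` are those of `𝓗'_k[c](σq ; q)`. -/
lemma rank_hank'_row (k c : ℕ) (q : α → β → ℕ → K) :
    (hank' K (k + 1) c q).rank = (hank' K k c (qrow K q)).rank := by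
  have hr : Set.range (hank' K (k + 1) c q).row = Set.range (hank' K k c (qrow K q)).row := by
    ext v
    constructor
    · rintro ⟨⟨a, i⟩, rfl⟩
      by_cases hi : (i : ℕ) ≤ k
      · refine ⟨⟨Sum.inr a, ⟨i, by omega⟩⟩, ?_⟩
        funext s
        simp [hank', qrow, Matrix.row]
      · have hi' : (i : ℕ) = k + 1 := by have := i.2; omega
        refine ⟨⟨Sum.inl a, ⟨k, by omega⟩⟩, ?_⟩
        funext s
        simp only [hank', qrow, Matrix.row, Matrix.of_apply, Sum.elim_inl, shift_apply]
        congr 1; omega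
    · rintro ⟨⟨a, i⟩, rfl⟩
      rcases a with a | a
      · refine ⟨⟨a, ⟨i + 1, by omega⟩⟩, ?_⟩
        funext s
        simp only [hank', qrow, Matrix.row, Matrix.of_apply, Sum.elim_inl, shift_apply]
        congr 1; omega
      · refine ⟨⟨a, ⟨i, by omega⟩⟩, ?_⟩
        funext s
        simp [hank', qrow, Matrix.row]
  rw [Matrix.rank_eq_finrank_span_row, Matrix.rank_eq_finrank_span_row, hr]

omit [Fintype α] [DecidableEq α] [DecidableEq β] in
/-- COLUMN DOUBLING: `rank 𝓗^{(m+1)}_k(q) = rank 𝓗^{(m)}_k(q ∣ σq)` for `k ≤ m`. -/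
lemma rank_hank_col {m k : ℕ} (hk : k ≤ m) (q : α → β → ℕ → K) :
    (hank K (m + 1) k q).rank = (hank K m k (qcol K q)).rank := by
  rw [hank, hank, Nat.succ_sub (by omega : k ≤ m + 1)]
  exact rank_hank'_col K k _ (by omega) q

omit [DecidableEq α] [DecidableEq β] in
/-- ROW DOUBLING: `rank 𝓗^{(m+1)}_{k+1}(q) = rank 𝓗^{(m)}_k(σq ; q)`. -/
lemma rank_hank_row (m k : ℕ) (q : α → β → ℕ → K) :
    (hank K (m + 1) (k + 1) q).rank = (hank K m k (qrow K q)).rank := by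
  rw [hank, hank, Nat.add_sub_add_right]
  exact rank_hank'_row K k _ q

omit [Fintype α] [DecidableEq α] [DecidableEq β] in
/-- no columns ⇒ rank 0 (degrees above the top). -/
lemma rank_hank_eq_zero_of_lt {m k : ℕ} (hk : m < k) (q : α → β → ℕ → K) :
    (hank K m k q).rank = 0 := by
  have h0 : m + 1 - k = 0 := by omega
  have h1 := Matrix.rank_le_card_width (hank K m k q)
  have h2 : Fintype.card (β × Fin (m + 1 - k)) = 0 := by
    rw [Fintype.card_prod, Fintype.card_fin, h0, mul_zero]
  omega

end Matrices

end Summit.Ventures.HSemireg.Wedge.Hankel
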